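import Mathlib
import Summits.CriticalPhenomena.CardyFormulaZ2.Theorems.CardyMagicRigidityDefs
import Summits.CriticalPhenomena.CardyFormulaZ2.Theorems.CardyMagicRigidityNestingRigidityPairEnergies
import HarnessLib

/-!
# Stub S1b `CloudEnergy` (line `ring-cloud-tomography`, crux `NestingRigidity`)

Crux `Summit.CriticalPhenomena.CardyFormulaZ2.Theses.CardyMagicRigidity.NestingRigidity`
(stmt-CriticalPhenomena-4835), line `ring-cloud-tomography`: the registered stub
`stub_cloudEnergy : CloudEnergy` — the logarithmic energy `∬ log ‖x - y‖ f(x) f(y) dx dy` of the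
density `f` of an ADMISSIBLE cloud is the explicit `Cloud.energy`.

Proof (part (D) of the stub plan): a disc is a ring with inner radius `0`
(`discDensity_eq_annulusDensity`), so `f = ∑_α q_α σ_α` over the combined index
`Fin m ⊕ Fin n`; the inner integral is `f(x) ∑_α q_α V_α(x)` with `V_α` the ring potentials
(integrability: the logarithm is locally integrable in the plane), the outer integral splits over
pairs `(β, α)` because every ordered pair of carriers of an admissible cloud is in one of the four
mean-value positions (same, inside, contains, exterior), where the pair energies and the
integrability of `σ_β V_α` are those of `CardyMagicRigidityNestingRigidityPairEnergies`; the
resulting double sum is matched block by block with `Cloud.energy`.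
-/

noncomputable section

open MeasureTheory Set Filter Metric Real
open scoped Real Topology BigOperators

namespace Summit.CriticalPhenomena.CardyFormulaZ2.Cruxes.NestingRigidity.RingCloudTomography

open Literature.Probability.RandomPlanarGeometry Literature.Probability.Percolation
  Literature.Probability.LatticeModels

/-! ## §1 Discs are rings with inner radius `0` -/

/-- The open disc is the annulus with inner radius `0`. -/
theorem ball_eq_annulus (x : ℂ) (r : ℝ) :
    ball x r = {z : ℂ | 0 ≤ ‖z - x‖ ∧ ‖z - x‖ < r} := by
  ext z
  simp [mem_ball, dist_eq_norm]

/-- The disc density is the ring density with inner radius `0`. -/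
theorem discDensity_eq_annulusDensity (x : ℂ) (r : ℝ) :
    discDensity x r = annulusDensity x 0 r := by
  funext z
  unfold discDensity annulusDensity
  rw [ball_eq_annulus]
  simp

/-- `ringSelfEnergy 0 r = discSelfEnergy r` for `r ≠ 0`. -/
theorem ringSelfEnergy_zero {r : ℝ} (hr : r ≠ 0) : ringSelfEnergy 0 r = discSelfEnergy r := by
  unfold ringSelfEnergy discSelfEnergy
  have : r ^ 4 ≠ 0 := pow_ne_zero 4 hr
  field_simp
  ring

/-! ## §2 The pair table of an admissible cloud

The carriers are indexed by `Fin m ⊕ Fin n` (discs first): centre `Sum.elim 𝔠.x 𝔠.c`, inner radius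
`Sum.elim (fun _ ↦ 0) 𝔠.L`, outer radius `Sum.elim 𝔠.r 𝔠.M`, charge `Sum.elim 𝔠.a 𝔠.g`. -/

section PairTable

variable (𝔠 : Cloud)

/-- The density of a cloud as ONE sum of ring densities over `Fin m ⊕ Fin n`. -/
theorem density_eq_sum (z : ℂ) :
    𝔠.density z = ∑ α, Sum.elim 𝔠.a 𝔠.g α *
      annulusDensity (Sum.elim 𝔠.x 𝔠.c α) (Sum.elim (fun _ ↦ (0 : ℝ)) 𝔠.L α)
        (Sum.elim 𝔠.r 𝔠.M α) z := by
  rw [Fintype.sum_sum_type]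
  simp [Cloud.density, discDensity_eq_annulusDensity]

variable {𝔠}

/-- Radii of an admissible cloud: `0 ≤` inner radius `<` outer radius. -/
theorem lo_nonneg_of_admissible (h : 𝔠.Admissible) (α : Fin 𝔠.m ⊕ Fin 𝔠.n) :
    0 ≤ Sum.elim (fun _ ↦ (0 : ℝ)) 𝔠.L α ∧
      Sum.elim (fun _ ↦ (0 : ℝ)) 𝔠.L α < Sum.elim 𝔠.r 𝔠.M α := by
  rcases α with i | k
  · simpa using h.r_pos i
  · simpa using ⟨(h.L_pos k).le, h.L_lt_M k⟩

/-- **Mean-value position of every ordered pair of distinct carriers** of an admissible cloud: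
inside, contains, or exterior. -/
theorem pair_position (h : 𝔠.Admissible) {β α : Fin 𝔠.m ⊕ Fin 𝔠.n} (hβα : β ≠ α) :
    ‖Sum.elim 𝔠.x 𝔠.c β - Sum.elim 𝔠.x 𝔠.c α‖ + Sum.elim 𝔠.r 𝔠.M β ≤
        Sum.elim (fun _ ↦ (0 : ℝ)) 𝔠.L α ∨
      ‖Sum.elim 𝔠.x 𝔠.c α - Sum.elim 𝔠.x 𝔠.c β‖ + Sum.elim 𝔠.r 𝔠.M α ≤
        Sum.elim (fun _ ↦ (0 : ℝ)) 𝔠.L β ∨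
      Sum.elim 𝔠.r 𝔠.M β + Sum.elim 𝔠.r 𝔠.M α ≤ ‖Sum.elim 𝔠.x 𝔠.c β - Sum.elim 𝔠.x 𝔠.c α‖ := by
  rcases β with i | k <;> rcases α with j | l
  · have hij : i ≠ j := fun e ↦ hβα (by rw [e])
    simpa using Or.inr (Or.inr (h.disc_disc i j hij))
  · rcases h.disc_ring i l with h1 | h1
    · simpa using Or.inl h1
    · refine Or.inr (Or.inr ?_)
      simpa [add_comm, norm_sub_rev] using h1
  · rcases h.disc_ring j k with h1 | h1
    · simpa using Or.inr (Or.inl h1)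
    · refine Or.inr (Or.inr ?_)
      simpa [add_comm, norm_sub_rev] using h1
  · have hkl : k ≠ l := fun e ↦ hβα (by rw [e])
    simpa using h.ring_ring k l hkl

/-- **Integrability of every pair term** `σ_β V_α` of an admissible cloud (each ordered pair of
carriers is in one of the four mean-value positions: same, inside, contains, exterior). -/
theorem pair_integrable (h : 𝔠.Admissible) (β α : Fin 𝔠.m ⊕ Fin 𝔠.n) :
    Integrable (fun x ↦
      annulusDensity (Sum.elim 𝔠.x 𝔠.c β) (Sum.elim (fun _ ↦ (0 : ℝ)) 𝔠.L β)
          (Sum.elim 𝔠.r 𝔠.M β) x *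
        ∫ y, Real.log ‖x - y‖ * annulusDensity (Sum.elim 𝔠.x 𝔠.c α)
          (Sum.elim (fun _ ↦ (0 : ℝ)) 𝔠.L α) (Sum.elim 𝔠.r 𝔠.M α) y) := by
  obtain ⟨hβ0, hβ1⟩ := lo_nonneg_of_admissible h β
  obtain ⟨hα0, hα1⟩ := lo_nonneg_of_admissible h α
  by_cases hβα : β = α
  · subst hβα
    exact (pairEnergy_self hβ0 hβ1).1
  rcases pair_position h hβα with h1 | h2 | h3
  · exact (pairEnergy_of_inside hβ0 hβ1 hα0 hα1 h1).1
  · exact (pairEnergy_of_contains hβ0 hβ1 hα0 hα1 h2).1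
  · exact (pairEnergy_of_exterior hβ0 hβ1 hα0 hα1 h3).1

/-- **Disc–disc block**: self-energy `log r - 1/4` on the diagonal, `log ‖x_i - x_j‖` off it. -/
theorem pairEnergy_disc_disc (h : 𝔠.Admissible) (i j : Fin 𝔠.m) :
    ∫ x, annulusDensity (𝔠.x i) 0 (𝔠.r i) x *
        ∫ y, Real.log ‖x - y‖ * annulusDensity (𝔠.x j) 0 (𝔠.r j) y =
      if i = j then discSelfEnergy (𝔠.r i) else Real.log ‖𝔠.x i - 𝔠.x j‖ := by
  by_cases hij : i = j
  · subst hij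
    rw [if_pos rfl, (pairEnergy_self le_rfl (h.r_pos i)).2, ringSelfEnergy_zero (h.r_pos i).ne']
  · rw [if_neg hij]
    exact (pairEnergy_of_exterior le_rfl (h.r_pos i) le_rfl (h.r_pos j) (h.disc_disc i j hij)).2

/-- **Disc–ring block**: `ringHolePotential` if the disc sits in the hole, else
`log ‖x_i - c_k‖`. -/
theorem pairEnergy_disc_ring (h : 𝔠.Admissible) (i : Fin 𝔠.m) (k : Fin 𝔠.n) :
    ∫ x, annulusDensity (𝔠.x i) 0 (𝔠.r i) x *
        ∫ y, Real.log ‖x - y‖ * annulusDensity (𝔠.c k) (𝔠.L k) (𝔠.M k) y =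
      if ‖𝔠.x i - 𝔠.c k‖ + 𝔠.r i ≤ 𝔠.L k then ringHolePotential (𝔠.L k) (𝔠.M k)
      else Real.log ‖𝔠.x i - 𝔠.c k‖ := by
  by_cases hc : ‖𝔠.x i - 𝔠.c k‖ + 𝔠.r i ≤ 𝔠.L k
  · rw [if_pos hc]
    exact (pairEnergy_of_inside le_rfl (h.r_pos i) (h.L_pos k).le (h.L_lt_M k) hc).2
  · rw [if_neg hc]
    rcases h.disc_ring i k with h1 | h1
    · exact absurd h1 hc
    · exact (pairEnergy_of_exterior le_rfl (h.r_pos i) (h.L_pos k).le (h.L_lt_M k)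
        (by linarith)).2

/-- **Ring–disc block**: the same value as the disc–ring block (symmetry of the pair energy in
mean-value position, obtained here from the two closed forms, not from Fubini). -/
theorem pairEnergy_ring_disc (h : 𝔠.Admissible) (k : Fin 𝔠.n) (i : Fin 𝔠.m) :
    ∫ x, annulusDensity (𝔠.c k) (𝔠.L k) (𝔠.M k) x *
        ∫ y, Real.log ‖x - y‖ * annulusDensity (𝔠.x i) 0 (𝔠.r i) y =
      if ‖𝔠.x i - 𝔠.c k‖ + 𝔠.r i ≤ 𝔠.L k then ringHolePotential (𝔠.L k) (𝔠.M k)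
      else Real.log ‖𝔠.x i - 𝔠.c k‖ := by
  by_cases hc : ‖𝔠.x i - 𝔠.c k‖ + 𝔠.r i ≤ 𝔠.L k
  · rw [if_pos hc]
    exact (pairEnergy_of_contains (h.L_pos k).le (h.L_lt_M k) le_rfl (h.r_pos i) hc).2
  · rw [if_neg hc, norm_sub_rev]
    rcases h.disc_ring i k with h1 | h1
    · exact absurd h1 hc
    · exact (pairEnergy_of_exterior (h.L_pos k).le (h.L_lt_M k) le_rfl (h.r_pos i)
        (by rw [norm_sub_rev]; linarith)).2

/-- **Ring–ring block**: self, nested either way (`ringHolePotential` of the outer ring), or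
mutually exterior (`log ‖c_k - c_l‖`). -/
theorem pairEnergy_ring_ring (h : 𝔠.Admissible) (k l : Fin 𝔠.n) :
    ∫ x, annulusDensity (𝔠.c k) (𝔠.L k) (𝔠.M k) x *
        ∫ y, Real.log ‖x - y‖ * annulusDensity (𝔠.c l) (𝔠.L l) (𝔠.M l) y =
      if k = l then ringSelfEnergy (𝔠.L k) (𝔠.M k)
      else if ‖𝔠.c k - 𝔠.c l‖ + 𝔠.M k ≤ 𝔠.L l then ringHolePotential (𝔠.L l) (𝔠.M l)
      else if ‖𝔠.c l - 𝔠.c k‖ + 𝔠.M l ≤ 𝔠.L k then ringHolePotential (𝔠.L k) (𝔠.M k)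
      else Real.log ‖𝔠.c k - 𝔠.c l‖ := by
  have hk0 := (h.L_pos k).le
  have hl0 := (h.L_pos l).le
  by_cases hkl : k = l
  · subst hkl
    rw [if_pos rfl]
    exact (pairEnergy_self hk0 (h.L_lt_M k)).2
  rw [if_neg hkl]
  have hsym : ‖𝔠.c l - 𝔠.c k‖ = ‖𝔠.c k - 𝔠.c l‖ := norm_sub_rev _ _
  rcases h.ring_ring k l hkl with h1 | h2 | h3
  · rw [if_pos h1]
    exact (pairEnergy_of_inside hk0 (h.L_lt_M k) hl0 (h.L_lt_M l) h1).2
  · have hn1 : ¬ (‖𝔠.c k - 𝔠.c l‖ + 𝔠.M k ≤ 𝔠.L l) := fun h1 ↦ by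
      linarith [norm_nonneg (𝔠.c k - 𝔠.c l), h.L_lt_M k, h.L_lt_M l]
    rw [if_neg hn1, if_pos h2]
    exact (pairEnergy_of_contains hk0 (h.L_lt_M k) hl0 (h.L_lt_M l) h2).2
  · have hn1 : ¬ (‖𝔠.c k - 𝔠.c l‖ + 𝔠.M k ≤ 𝔠.L l) := fun h1 ↦ by
      linarith [h.L_lt_M k, h.L_lt_M l]
    have hn2 : ¬ (‖𝔠.c l - 𝔠.c k‖ + 𝔠.M l ≤ 𝔠.L k) := fun h2 ↦ by
      linarith [h.L_lt_M k, h.L_lt_M l]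
    rw [if_neg hn1, if_neg hn2]
    exact (pairEnergy_of_exterior hk0 (h.L_lt_M k) hl0 (h.L_lt_M l) h3).2

/-! ## §3 The bilinear expansion -/

/-- The inner integral: `∫ log ‖x - y‖ f(x) f(y) dy = f(x) ∑_α q_α V_α(x)`. -/
theorem inner_integral_eq (x : ℂ) :
    ∫ y, Real.log ‖x - y‖ * 𝔠.density x * 𝔠.density y =
      𝔠.density x * ∑ α, Sum.elim 𝔠.a 𝔠.g α *
        ∫ y, Real.log ‖x - y‖ * annulusDensity (Sum.elim 𝔠.x 𝔠.c α)
          (Sum.elim (fun _ ↦ (0 : ℝ)) 𝔠.L α) (Sum.elim 𝔠.r 𝔠.M α) y := by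
  have h1 : ∀ y, Real.log ‖x - y‖ * 𝔠.density x * 𝔠.density y =
      𝔠.density x * ∑ α, Sum.elim 𝔠.a 𝔠.g α *
        (Real.log ‖x - y‖ * annulusDensity (Sum.elim 𝔠.x 𝔠.c α)
          (Sum.elim (fun _ ↦ (0 : ℝ)) 𝔠.L α) (Sum.elim 𝔠.r 𝔠.M α) y) := by
    intro y
    rw [density_eq_sum 𝔠 y, Finset.mul_sum, Finset.mul_sum]
    refine Finset.sum_congr rfl fun α _ ↦ ?_
    ring
  simp_rw [h1]
  rw [integral_const_mul, integral_finsetSum _ fun α _ ↦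
    (integrable_log_mul_annulusDensity _ x _ _).const_mul _]
  simp_rw [integral_const_mul]

/-- **The bilinear expansion**: for an admissible cloud,
`∬ log ‖x - y‖ f(x) f(y) = ∑_β ∑_α q_β q_α ∫ σ_β V_α`. -/
theorem energy_integral_eq_sum (h : 𝔠.Admissible) :
    ∫ x, ∫ y, Real.log ‖x - y‖ * 𝔠.density x * 𝔠.density y =
      ∑ β, ∑ α, Sum.elim 𝔠.a 𝔠.g β * Sum.elim 𝔠.a 𝔠.g α *
        ∫ x, annulusDensity (Sum.elim 𝔠.x 𝔠.c β) (Sum.elim (fun _ ↦ (0 : ℝ)) 𝔠.L β)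
            (Sum.elim 𝔠.r 𝔠.M β) x *
          ∫ y, Real.log ‖x - y‖ * annulusDensity (Sum.elim 𝔠.x 𝔠.c α)
            (Sum.elim (fun _ ↦ (0 : ℝ)) 𝔠.L α) (Sum.elim 𝔠.r 𝔠.M α) y := by
  simp_rw [inner_integral_eq]
  have h2 : ∀ x, 𝔠.density x * ∑ α, Sum.elim 𝔠.a 𝔠.g α *
      ∫ y, Real.log ‖x - y‖ * annulusDensity (Sum.elim 𝔠.x 𝔠.c α)
        (Sum.elim (fun _ ↦ (0 : ℝ)) 𝔠.L α) (Sum.elim 𝔠.r 𝔠.M α) y =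
      ∑ β, ∑ α, Sum.elim 𝔠.a 𝔠.g β * Sum.elim 𝔠.a 𝔠.g α *
        (annulusDensity (Sum.elim 𝔠.x 𝔠.c β) (Sum.elim (fun _ ↦ (0 : ℝ)) 𝔠.L β)
            (Sum.elim 𝔠.r 𝔠.M β) x *
          ∫ y, Real.log ‖x - y‖ * annulusDensity (Sum.elim 𝔠.x 𝔠.c α)
            (Sum.elim (fun _ ↦ (0 : ℝ)) 𝔠.L α) (Sum.elim 𝔠.r 𝔠.M α) y) := by
    intro x
    rw [density_eq_sum 𝔠 x, Finset.sum_mul_sum]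
    refine Finset.sum_congr rfl fun β _ ↦ Finset.sum_congr rfl fun α _ ↦ ?_
    ring
  simp_rw [h2]
  rw [integral_finsetSum _ fun β _ ↦ integrable_finsetSum _ fun α _ ↦
    ((pair_integrable h β α).const_mul _)]
  refine Finset.sum_congr rfl fun β _ ↦ ?_
  rw [integral_finsetSum _ fun α _ ↦ ((pair_integrable h β α).const_mul _)]
  refine Finset.sum_congr rfl fun α _ ↦ ?_
  rw [integral_const_mul]

/-! ## §4 Matching with `Cloud.energy` -/

/-- Block decomposition of a quadratic form over `Fin m ⊕ Fin n` whose two mixed blocks agree. -/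
theorem sum_sum_elim_eq {m n : ℕ} (a : Fin m → ℝ) (g : Fin n → ℝ)
    (T : Fin m ⊕ Fin n → Fin m ⊕ Fin n → ℝ) (DD : Fin m → Fin m → ℝ) (DR : Fin m → Fin n → ℝ)
    (RR : Fin n → Fin n → ℝ) (hdd : ∀ i j, T (Sum.inl i) (Sum.inl j) = DD i j)
    (hdr : ∀ i k, T (Sum.inl i) (Sum.inr k) = DR i k)
    (hrd : ∀ k i, T (Sum.inr k) (Sum.inl i) = DR i k)
    (hrr : ∀ k l, T (Sum.inr k) (Sum.inr l) = RR k l) :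
    ∑ β, ∑ α, Sum.elim a g β * Sum.elim a g α * T β α =
      (∑ i, ∑ j, a i * a j * DD i j) + 2 * (∑ i, ∑ k, a i * g k * DR i k) +
        ∑ k, ∑ l, g k * g l * RR k l := by
  rw [Fintype.sum_sum_type]
  simp only [Fintype.sum_sum_type, Sum.elim_inl, Sum.elim_inr, hdd, hdr, hrd, hrr,
    Finset.sum_add_distrib]
  have hswap : ∑ k, ∑ i, g k * a i * DR i k = ∑ i, ∑ k, a i * g k * DR i k := by
    rw [Finset.sum_comm]
    exact Finset.sum_congr rfl fun i _ ↦ Finset.sum_congr rfl fun k _ ↦ by ring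
  rw [hswap]
  ring

end PairTable

/-- **Stub S1b.** The logarithmic energy `∬ log ‖x - y‖ f(x) f(y)` of the density of an admissible
cloud is the explicit `Cloud.energy`. -/
theorem stub_cloudEnergy : CloudEnergy := by
  intro 𝔠 h
  rw [energy_integral_eq_sum h]
  exact sum_sum_elim_eq 𝔠.a 𝔠.g
    (fun β α ↦ ∫ x, annulusDensity (Sum.elim 𝔠.x 𝔠.c β) (Sum.elim (fun _ ↦ (0 : ℝ)) 𝔠.L β)
        (Sum.elim 𝔠.r 𝔠.M β) x *
      ∫ y, Real.log ‖x - y‖ * annulusDensity (Sum.elim 𝔠.x 𝔠.c α)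
        (Sum.elim (fun _ ↦ (0 : ℝ)) 𝔠.L α) (Sum.elim 𝔠.r 𝔠.M α) y)
    (fun i j ↦ if i = j then discSelfEnergy (𝔠.r i) else Real.log ‖𝔠.x i - 𝔠.x j‖)
    (fun i k ↦ if ‖𝔠.x i - 𝔠.c k‖ + 𝔠.r i ≤ 𝔠.L k then ringHolePotential (𝔠.L k) (𝔠.M k)
      else Real.log ‖𝔠.x i - 𝔠.c k‖)
    (fun k l ↦ if k = l then ringSelfEnergy (𝔠.L k) (𝔠.M k)
      else if ‖𝔠.c k - 𝔠.c l‖ + 𝔠.M k ≤ 𝔠.L l then ringHolePotential (𝔠.L l) (𝔠.M l)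
      else if ‖𝔠.c l - 𝔠.c k‖ + 𝔠.M l ≤ 𝔠.L k then ringHolePotential (𝔠.L k) (𝔠.M k)
      else Real.log ‖𝔠.c k - 𝔠.c l‖)
    (pairEnergy_disc_disc h) (pairEnergy_disc_ring h) (pairEnergy_ring_disc h)
    (pairEnergy_ring_ring h)


end Summit.CriticalPhenomena.CardyFormulaZ2.Cruxes.NestingRigidity.RingCloudTomography

end
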